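import Summits.QuantumFields.BalabanUV.T4Continuum.Support.VariationalColourTaxiOneMinDecayCore

/-!
# T⁴ programme, spine node NE2 (U1a), lane P2 — «V-AVG-G AT TAXI DATA», file 7b: THE DECAY OF THE (ONE-min) TRANSFER OUTPUTS — ASSEMBLY (`ε`, `v`, `γ`, `δ′`, `A`, `B`, outputs)
# (the `let` telescope of leaf-04-g7's `VariationalColourTaxiTowerCentred.hONEm_taxi` over ABSTRACT atoms, all five free parameters set to `τ = θ^k`;
# Mathlib only; model level; cell `pub-balaban`)

NE2 formalisation swarm `b2b-balaban-t4-ne2-formalise-*`, leaf prover 10 GEN 5 (`prover-b2b-balaban-t4-ne2-formalise-leaf-10-g5-0`, V-END holder lineage); item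
«V-AVG-G AT TAXI DATA», file 7b (journal NOTE l.22515): the second half of file 7 `VariationalColourTaxiOneMinDecayCore` (§0–§2: `pow_facts`, `eH_le`, `e2_le`), split at the 400-line limit; imports only it; nothing defined.

THE SHAPE.  `hONEm_taxi` (p238755) outputs, per level `k`, the (ONE-min) costs `ε₁ = (A−1) + A·ε + B` and `δ′₁ = √A·δ′`, where `eH, e₂, ε, δ′, v, γ, Λf, A, B` are an
explicit telescope in: the level size `N = L^k`, the level plaquette bound `a`, ONE⁺'s size `X = (d−1)(L−1)(2L−1)b_k`, FED⁺'s size `Y = (d−1)L(L−1)b_k`, the two-step frame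
distance `F = L(L^k−1)(L−1)b_k`, the composite frames' reverse-Poincaré constant `R`, the fine plaquette number `NB = (L^{k+1})²b_k`, the supplier's fine V-UB constant `Λᵥ`,
the package's `Λf`, the colour pair's `Λ, C_P, C_R`, the V-REG constant `C_Rv`, the (GF3) constants `C_D, C_D′, C_D₁, C_D₁′`, and the free `s, t, u, u₂, w`.  THIS FILE bounds
that telescope — written VERBATIM over abstract real atoms, with `s = t = u = u₂ = w := τ` — by `C·τ` from the ATOM BOUNDS the taxi class delivers (file 6
`VariationalColourTaxiClassReadings`): `(N²)⁻¹ ≤ τ⁴`, `N·X ≤ C_X τ²`, `X ≤ C_X τ⁴`, `N·Y ≤ C_Y τ²`, `Y ≤ C_Y τ⁴`, `N²a ≤ c`, `a²N² ≤ c²τ⁴`, `NB ≤ c`, `F ≤ cτ²`, `R ≤ R⋆`,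
`Λᵥ ≤ Λᵥ⋆`, `Λf ≤ Λf⋆`, `0 < τ ≤ 1`:
 * §1 `eH_le` (`eH ≤ E_H⋆·τ²`), §2 `e2_le` (`0 ≤ e₂ ≤ E₂⋆·τ`), §3 `eps_le` (`0 ≤ ε ≤ E⋆·τ`), §4 `v_le` ∕ `gamma_le` ∕ `deltaP_le` (`v ≤ V⋆τ`, `γ ≤ Γ⋆τ⁴`, `δ′ ≤ D⋆τ²`),
   §5 `AB_le` (`A ≤ A⋆`, `A − 1 ≤ A₁⋆τ`, `B ≤ B⋆τ`), §6 **`oneMin_outputs_le`**: `(A−1) + A·ε + B ≤ (A₁⋆ + A⋆E⋆ + B⋆)·τ` and `√A·δ′ ≤ √A⋆D⋆·τ`, `v ≤ V⋆`, `γ ≤ Γ⋆`,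
   the starred constants written out as `let`s (each sub-lemma keeps its own small context — the telescope is assembled by typed `have`s only).
THIS FILE = §3–§6 (`eps_le`, `v_le`, `gamma_le`, `deltaP_le`, `AB_le`, `oneMin_outputs_le`).
The instance at Bałaban's taxi data (atoms := the tower's quantities, bounds := file 6 + the class package) is the next file.

HONEST FRAMING (T4-DAG p. 1).  Real algebra only; OUR constants; thresholds quantitatively void; nothing printed is a hypothesis; no `def`, no `def … : Prop`, no `sorry`;
axioms standard.  NOT an END statement; V-END with background ∕ NE2 NOT proved; NE3 OPEN; spine PROVED 0∕9 unchanged; rung (B)+1 on a fixed finite T⁴ — NOT infinite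
volume, NOT mass gap, NOT Clay.  HONEST DEPENDENCY (cell, verbatim): continuum YM on T⁴ ⇐ BetaPertH ∧ nine spine estimates (0/9 proved); BetaPertH ⇐ (D1) ∧ (D4) ∧
CAP+tail; G-an2-4 gates asym, D1 and NE2/3/4.
-/

noncomputable section

namespace Summit.QuantumFields.BalabanUV.T4Continuum.VariationalColourTaxiOneMinDecay

open Summit.QuantumFields.BalabanUV.T4Continuum.VariationalColourTaxiOneMinDecayCore

/-! ## §3 The transfer's trial budget `ε` -/

/-- **`0 ≤ ε ≤ E⋆·τ`** (`s = u := τ`): `(τ + (1+τ⁻¹)dL∕N²)(1+C_Rv) ≤ (1+2dL)(1+C_Rv)τ`, `(1+τ)(…) ≤ 2(…)`, `(1+τ⁻¹)Λᵥ(25∕4)(N⁻²κ) ≤ 2Λᵥ⋆(25∕4)κ⋆·τ`. [folklore] -/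
theorem eps_le {d L : ℕ} {N a CRv CD CD' c τ e₂ E2s Lv Lvs : ℝ} (hτ0 : 0 < τ) (hτ1 : τ ≤ 1) (hNi : (N ^ 2)⁻¹ ≤ τ ^ 4)
    (ha0 : 0 ≤ a) (hna : N ^ 2 * a ≤ c) (hCRv : 0 ≤ CRv) (hCD : 0 ≤ CD) (hCD' : 0 ≤ CD') (hc0 : 0 ≤ c)
    (he20 : 0 ≤ e₂) (he2 : e₂ ≤ E2s * τ) (hLv0 : 0 ≤ Lv) (hLv : Lv ≤ Lvs) :
    0 ≤ τ + (1 + τ) * ((τ + (1 + τ⁻¹) * (d * (L : ℝ) / N ^ 2)) * (1 + CRv) + e₂)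
      + (1 + τ⁻¹) * (Lv * (25 / 4 * ((N ^ 2)⁻¹ * ((2 * (1 + CD)) + (2 * (CD' + d * (N ^ 2 * a) * 64))))))
    ∧ τ + (1 + τ) * ((τ + (1 + τ⁻¹) * (d * (L : ℝ) / N ^ 2)) * (1 + CRv) + e₂)
      + (1 + τ⁻¹) * (Lv * (25 / 4 * ((N ^ 2)⁻¹ * ((2 * (1 + CD)) + (2 * (CD' + d * (N ^ 2 * a) * 64))))))
      ≤ (1 + 2 * ((1 + 2 * (d * (L : ℝ))) * (1 + CRv) + E2s) + 2 * (Lvs * (25 / 4 * ((2 * (1 + CD)) + (2 * (CD' + d * c * 64)))))) * τ := by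
  obtain ⟨h42, h3, h2, h4⟩ := pow_facts hτ0.le hτ1
  have hτ40 : 0 ≤ τ ^ 4 := by positivity
  have hd0 : (0 : ℝ) ≤ d := Nat.cast_nonneg d
  have hL0 : (0 : ℝ) ≤ L := Nat.cast_nonneg L
  have hi0 : 0 ≤ 1 + τ⁻¹ := add_nonneg zero_le_one (inv_nonneg.mpr hτ0.le)
  have hN20 : 0 ≤ (N ^ 2)⁻¹ := inv_nonneg.mpr (sq_nonneg N)
  have hLvs0 : 0 ≤ Lvs := hLv0.trans hLv
  have hE2s0 : 0 ≤ E2s * τ := he20.trans he2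
  have hdna : (d : ℝ) * (N ^ 2 * a) * 64 ≤ d * c * 64 := mul_le_mul_of_nonneg_right (mul_le_mul_of_nonneg_left hna hd0) (by norm_num)
  have hκ : ((2 * (1 + CD)) + (2 * (CD' + d * (N ^ 2 * a) * 64))) ≤ ((2 * (1 + CD)) + (2 * (CD' + d * c * 64))) := by linarith
  have hκ0 : 0 ≤ ((2 * (1 + CD)) + (2 * (CD' + d * (N ^ 2 * a) * 64))) := by positivity
  have hdiv : d * (L : ℝ) / N ^ 2 ≤ d * (L : ℝ) * τ ^ 4 := by
    rw [div_eq_mul_inv]; exact mul_le_mul_of_nonneg_left hNi (by positivity)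
  have hdiv0 : 0 ≤ d * (L : ℝ) / N ^ 2 := by
    rw [div_eq_mul_inv]; positivity
  have h11 : (1 + τ⁻¹) * (d * (L : ℝ) / N ^ 2) ≤ 2 * (d * (L : ℝ)) * τ :=
    (mul_le_mul_of_nonneg_left hdiv hi0).trans (one_add_inv_mul_pow4_le hτ0 hτ1 (by positivity))
  have h1 : (τ + (1 + τ⁻¹) * (d * (L : ℝ) / N ^ 2)) * (1 + CRv) ≤ ((1 + 2 * (d * (L : ℝ))) * (1 + CRv)) * τ := by
    calc (τ + (1 + τ⁻¹) * (d * (L : ℝ) / N ^ 2)) * (1 + CRv) ≤ (τ + 2 * (d * (L : ℝ)) * τ) * (1 + CRv) :=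
          mul_le_mul_of_nonneg_right (by linarith) (by positivity)
      _ = ((1 + 2 * (d * (L : ℝ))) * (1 + CRv)) * τ := by ring
  have h10 : 0 ≤ (τ + (1 + τ⁻¹) * (d * (L : ℝ) / N ^ 2)) * (1 + CRv) := by positivity
  have h2x : (1 + τ) * ((τ + (1 + τ⁻¹) * (d * (L : ℝ) / N ^ 2)) * (1 + CRv) + e₂) ≤ 2 * ((((1 + 2 * (d * (L : ℝ))) * (1 + CRv)) + E2s) * τ) := by
    have h21 : (τ + (1 + τ⁻¹) * (d * (L : ℝ) / N ^ 2)) * (1 + CRv) + e₂ ≤ (((1 + 2 * (d * (L : ℝ))) * (1 + CRv)) + E2s) * τ :=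
      (add_le_add h1 he2).trans (le_of_eq (by ring))
    exact mul_le_mul (by linarith) h21 (add_nonneg h10 he20) (by norm_num)
  have h3x : (1 + τ⁻¹) * (Lv * (25 / 4 * ((N ^ 2)⁻¹ * ((2 * (1 + CD)) + (2 * (CD' + d * (N ^ 2 * a) * 64)))))) ≤ 2 * (Lvs * (25 / 4 * ((2 * (1 + CD)) + (2 * (CD' + d * c * 64))))) * τ := by
    have h31 : Lv * (25 / 4 * ((N ^ 2)⁻¹ * ((2 * (1 + CD)) + (2 * (CD' + d * (N ^ 2 * a) * 64))))) ≤ (Lvs * (25 / 4 * ((2 * (1 + CD)) + (2 * (CD' + d * c * 64))))) * τ ^ 4 := by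
      calc Lv * (25 / 4 * ((N ^ 2)⁻¹ * ((2 * (1 + CD)) + (2 * (CD' + d * (N ^ 2 * a) * 64))))) ≤ Lvs * (25 / 4 * (τ ^ 4 * ((2 * (1 + CD)) + (2 * (CD' + d * c * 64))))) :=
            mul_le_mul hLv (mul_le_mul_of_nonneg_left (mul_le_mul hNi hκ hκ0 hτ40) (by norm_num)) (by positivity) hLvs0
        _ = (Lvs * (25 / 4 * ((2 * (1 + CD)) + (2 * (CD' + d * c * 64))))) * τ ^ 4 := by ring
    exact (mul_le_mul_of_nonneg_left h31 hi0).trans (one_add_inv_mul_pow4_le hτ0 hτ1 (by positivity))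
  refine ⟨by positivity, ?_⟩
  calc τ + (1 + τ) * ((τ + (1 + τ⁻¹) * (d * (L : ℝ) / N ^ 2)) * (1 + CRv) + e₂)
      + (1 + τ⁻¹) * (Lv * (25 / 4 * ((N ^ 2)⁻¹ * ((2 * (1 + CD)) + (2 * (CD' + d * (N ^ 2 * a) * 64))))))
      ≤ τ + 2 * ((((1 + 2 * (d * (L : ℝ))) * (1 + CRv)) + E2s) * τ) + 2 * (Lvs * (25 / 4 * ((2 * (1 + CD)) + (2 * (CD' + d * c * 64))))) * τ := add_le_add (add_le_add le_rfl h2x) h3x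
    _ = (1 + 2 * ((1 + 2 * (d * (L : ℝ))) * (1 + CRv) + E2s) + 2 * (Lvs * (25 / 4 * ((2 * (1 + CD)) + (2 * (CD' + d * c * 64)))))) * τ := by ring

/-! ## §4 The swap cost `v`, the nearness numbers `γ`, the mixed-term size `δ′` -/

/-- **`0 ≤ v ≤ V⋆·τ`** (`u₂ := τ`): `δ_swap = 4d²F·R ≤ 4d²c·R⋆·τ²`, `(1+τ⁻¹)δ_swap² ≤ 2(4d²cR⋆)²τ`, `κ₁+κ₁′ ≤ κ₁⋆` (`NB ≤ c`). [folklore] -/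
theorem v_le {d : ℕ} {F R NB CD₁ CD₁' c RPc τ : ℝ} (hτ0 : 0 < τ) (hτ1 : τ ≤ 1) (hF0 : 0 ≤ F) (hF : F ≤ c * τ ^ 2) (hR0 : 0 ≤ R) (hR : R ≤ RPc)
    (hNB0 : 0 ≤ NB) (hNB : NB ≤ c) (hCD₁ : 0 ≤ CD₁) (hCD₁' : 0 ≤ CD₁') (hc0 : 0 ≤ c) :
    0 ≤ (1 + τ⁻¹) * (4 * ((d : ℝ) * ((d : ℝ) * F))
          * R) ^ 2
        * ((d : ℝ) * ((2 * (1 + CD₁)) + (2 * (CD₁' + d * NB * 64))))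
    ∧ (1 + τ⁻¹) * (4 * ((d : ℝ) * ((d : ℝ) * F))
          * R) ^ 2
        * ((d : ℝ) * ((2 * (1 + CD₁)) + (2 * (CD₁' + d * NB * 64))))
      ≤ (2 * ((4 * ((d : ℝ) * ((d : ℝ) * c)) * RPc) ^ 2 * ((d : ℝ) * ((2 * (1 + CD₁)) + (2 * (CD₁' + d * c * 64)))))) * τ
    ∧ 0 ≤ (2 * ((4 * ((d : ℝ) * ((d : ℝ) * c)) * RPc) ^ 2 * ((d : ℝ) * ((2 * (1 + CD₁)) + (2 * (CD₁' + d * c * 64)))))) := by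
  have hd0 : (0 : ℝ) ≤ d := Nat.cast_nonneg d
  have hi0 : 0 ≤ 1 + τ⁻¹ := add_nonneg zero_le_one (inv_nonneg.mpr hτ0.le)
  have hRPc0 : 0 ≤ RPc := hR0.trans hR
  have hdNB : (d : ℝ) * NB * 64 ≤ d * c * 64 := mul_le_mul_of_nonneg_right (mul_le_mul_of_nonneg_left hNB hd0) (by norm_num)
  have hκ1 : ((2 * (1 + CD₁)) + (2 * (CD₁' + d * NB * 64))) ≤ ((2 * (1 + CD₁)) + (2 * (CD₁' + d * c * 64))) := by linarith
  have hsw : 4 * ((d : ℝ) * ((d : ℝ) * F)) * R ≤ (4 * ((d : ℝ) * ((d : ℝ) * c)) * RPc) * τ ^ 2 := by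
    calc 4 * ((d : ℝ) * ((d : ℝ) * F)) * R ≤ 4 * ((d : ℝ) * ((d : ℝ) * (c * τ ^ 2))) * RPc :=
          mul_le_mul (mul_le_mul_of_nonneg_left (mul_le_mul_of_nonneg_left (mul_le_mul_of_nonneg_left hF hd0) hd0) (by norm_num)) hR hR0 (by positivity)
      _ = _ := by ring
  have hsw0 : 0 ≤ 4 * ((d : ℝ) * ((d : ℝ) * F)) * R := by positivity
  have hsq : (4 * ((d : ℝ) * ((d : ℝ) * F)) * R) ^ 2 ≤ (4 * ((d : ℝ) * ((d : ℝ) * c)) * RPc) ^ 2 * τ ^ 4 := by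
    calc (4 * ((d : ℝ) * ((d : ℝ) * F)) * R) ^ 2 ≤ ((4 * ((d : ℝ) * ((d : ℝ) * c)) * RPc) * τ ^ 2) ^ 2 := pow_le_pow_left₀ hsw0 hsw 2
      _ = _ := by ring
  have h1 : (1 + τ⁻¹) * (4 * ((d : ℝ) * ((d : ℝ) * F)) * R) ^ 2 ≤ 2 * ((4 * ((d : ℝ) * ((d : ℝ) * c)) * RPc) ^ 2) * τ :=
    (mul_le_mul_of_nonneg_left hsq hi0).trans (one_add_inv_mul_pow4_le hτ0 hτ1 (by positivity))
  refine ⟨by positivity, ?_, by positivity⟩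
  calc (1 + τ⁻¹) * (4 * ((d : ℝ) * ((d : ℝ) * F))
          * R) ^ 2
        * ((d : ℝ) * ((2 * (1 + CD₁)) + (2 * (CD₁' + d * NB * 64))))
      ≤ (2 * ((4 * ((d : ℝ) * ((d : ℝ) * c)) * RPc) ^ 2) * τ) * ((d : ℝ) * ((2 * (1 + CD₁)) + (2 * (CD₁' + d * c * 64)))) :=
        mul_le_mul h1 (mul_le_mul_of_nonneg_left hκ1 hd0) (by positivity) (by positivity)
    _ = (2 * ((4 * ((d : ℝ) * ((d : ℝ) * c)) * RPc) ^ 2 * ((d : ℝ) * ((2 * (1 + CD₁)) + (2 * (CD₁' + d * c * 64)))))) * τ := by ring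

/-- **`0 ≤ γ ≤ Γ⋆·τ⁴`**, `0 ≤ Γ⋆`: `γ = (3Y)²·C_Pf ≤ 9C_Y²τ⁸·C_Pf⋆ ≤ Γ⋆τ⁴`. [folklore] -/
theorem gamma_le {d : ℕ} {Y NB CD₁ CD₁' c CY τ : ℝ} (hτ0 : 0 < τ) (hτ1 : τ ≤ 1) (hY0 : 0 ≤ Y) (hY : Y ≤ CY * τ ^ 4)
    (hNB : NB ≤ c) (hCD₁ : 0 ≤ CD₁) :
    0 ≤ (3 * Y) ^ 2 * max (40 * (2 * (1 + CD₁))) (64 + 40 * (2 * (CD₁' + d * NB * 64)))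
    ∧ (3 * Y) ^ 2 * max (40 * (2 * (1 + CD₁))) (64 + 40 * (2 * (CD₁' + d * NB * 64))) ≤ ((3 * CY) ^ 2 * (max (40 * (2 * (1 + CD₁))) (64 + 40 * (2 * (CD₁' + d * c * 64))))) * τ ^ 4
    ∧ 0 ≤ ((3 * CY) ^ 2 * (max (40 * (2 * (1 + CD₁))) (64 + 40 * (2 * (CD₁' + d * c * 64))))) := by
  obtain ⟨h42, h3, h2, h4⟩ := pow_facts hτ0.le hτ1
  have hτ40 : 0 ≤ τ ^ 4 := by positivity
  have hτ41 : τ ^ 4 ≤ 1 := h4.trans hτ1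
  have hτ84 : τ ^ 4 * τ ^ 4 ≤ τ ^ 4 := mul_le_of_le_one_right hτ40 hτ41
  have hd0 : (0 : ℝ) ≤ d := Nat.cast_nonneg d
  have hdNB : (d : ℝ) * NB * 64 ≤ d * c * 64 := mul_le_mul_of_nonneg_right (mul_le_mul_of_nonneg_left hNB hd0) (by norm_num)
  have hCPf : (max (40 * (2 * (1 + CD₁))) (64 + 40 * (2 * (CD₁' + d * NB * 64)))) ≤ (max (40 * (2 * (1 + CD₁))) (64 + 40 * (2 * (CD₁' + d * c * 64)))) := max_le_max le_rfl (by linarith)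
  have hCPf0 : 0 ≤ (max (40 * (2 * (1 + CD₁))) (64 + 40 * (2 * (CD₁' + d * NB * 64)))) := le_max_of_le_left (by positivity)
  have h1 : (3 * Y) ^ 2 ≤ (3 * CY) ^ 2 * τ ^ 4 := by
    calc (3 * Y) ^ 2 ≤ (3 * (CY * τ ^ 4)) ^ 2 := pow_le_pow_left₀ (by positivity) (by linarith) 2
      _ = (3 * CY) ^ 2 * (τ ^ 4 * τ ^ 4) := by ring
      _ ≤ (3 * CY) ^ 2 * τ ^ 4 := mul_le_mul_of_nonneg_left hτ84 (sq_nonneg _)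
  refine ⟨by positivity, ?_, mul_nonneg (sq_nonneg _) (hCPf0.trans hCPf)⟩
  calc (3 * Y) ^ 2 * max (40 * (2 * (1 + CD₁))) (64 + 40 * (2 * (CD₁' + d * NB * 64))) ≤ ((3 * CY) ^ 2 * τ ^ 4) * (max (40 * (2 * (1 + CD₁))) (64 + 40 * (2 * (CD₁' + d * c * 64)))) := mul_le_mul h1 hCPf hCPf0 (by positivity)
    _ = _ := by ring

/-- **`0 ≤ δ′ ≤ D⋆·τ²`**, `0 ≤ D⋆`: `δ′ = √(8d(1+d²))·(N·L·X)`, `N·X ≤ C_Xτ²`. [folklore] -/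
theorem deltaP_le {d L : ℕ} {N X CX τ : ℝ} (hN0 : 0 < N) (hX0 : 0 ≤ X) (hCX0 : 0 ≤ CX) (hXN : N * X ≤ CX * τ ^ 2) :
    0 ≤ Real.sqrt (8 * d * (1 + (d : ℝ) ^ 2)) * (N * L * X)
    ∧ Real.sqrt (8 * d * (1 + (d : ℝ) ^ 2)) * (N * L * X) ≤ (Real.sqrt (8 * d * (1 + (d : ℝ) ^ 2)) * (L * CX)) * τ ^ 2
    ∧ 0 ≤ (Real.sqrt (8 * d * (1 + (d : ℝ) ^ 2)) * (L * CX)) := by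
  have hL0 : (0 : ℝ) ≤ L := Nat.cast_nonneg L
  have h1 : N * L * X ≤ L * CX * τ ^ 2 := by
    calc N * L * X = L * (N * X) := by ring
      _ ≤ L * (CX * τ ^ 2) := mul_le_mul_of_nonneg_left hXN hL0
      _ = L * CX * τ ^ 2 := by ring
  refine ⟨by positivity, ?_, by positivity⟩
  calc Real.sqrt (8 * d * (1 + (d : ℝ) ^ 2)) * (N * L * X) ≤ Real.sqrt (8 * d * (1 + (d : ℝ) ^ 2)) * (L * CX * τ ^ 2) := mul_le_mul_of_nonneg_left h1 (Real.sqrt_nonneg _)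
    _ = _ := by ring

/-! ## §5 The FED⁺ transfer factors `A`, `B` -/

/-- **`A`, `B` (`w = u₂ := τ`)**: `0 ≤ A ≤ A⋆`, `A − 1 ≤ A₁⋆·τ`, `B ≤ B⋆·τ`, `0 ≤ A⋆`, `1 ≤ A`, `0 ≤ B`, from `v ≤ V⋆τ`, `γ ≤ Γ⋆τ⁴`, `Λf ≤ Λf⋆`. [folklore] -/
theorem AB_le {τ v γ Lf Vs Gs Lfs : ℝ} (hτ0 : 0 < τ) (hτ1 : τ ≤ 1) (hv0 : 0 ≤ v) (hvle : v ≤ Vs * τ) (hγ0 : 0 ≤ γ) (hγle : γ ≤ Gs * τ ^ 4)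
    (hLf0 : 0 ≤ Lf) (hLf : Lf ≤ Lfs) (hVs0 : 0 ≤ Vs) (hGs0 : 0 ≤ Gs) :
    0 ≤ (1 + τ + (1 + τ⁻¹) * (Lf * γ) * (1 + 4 * γ)) * (1 + 4 * v) * (1 + τ)
    ∧ (1 + τ + (1 + τ⁻¹) * (Lf * γ) * (1 + 4 * γ)) * (1 + 4 * v) * (1 + τ) ≤ ((1 + (1 + 2 * (Lfs * Gs) * (1 + 4 * Gs))) * (1 + 4 * Vs) * 2)
    ∧ (1 + τ + (1 + τ⁻¹) * (Lf * γ) * (1 + 4 * γ)) * (1 + 4 * v) * (1 + τ) - 1 ≤ (1 + 2 * (1 + 2 * (Lfs * Gs) * (1 + 4 * Gs)) + 8 * Vs + 8 * (1 + 2 * (Lfs * Gs) * (1 + 4 * Gs)) * Vs) * τ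
    ∧ (1 + τ + (1 + τ⁻¹) * (Lf * γ) * (1 + 4 * γ)) * (1 + 4 * v) * (4 * v) + 4 * ((1 + τ⁻¹) * (Lf * γ)) ≤ (4 * Vs * ((1 + (1 + 2 * (Lfs * Gs) * (1 + 4 * Gs))) * (1 + 4 * Vs)) + 8 * (Lfs * Gs)) * τ
    ∧ 0 ≤ ((1 + (1 + 2 * (Lfs * Gs) * (1 + 4 * Gs))) * (1 + 4 * Vs) * 2)
    ∧ 1 ≤ (1 + τ + (1 + τ⁻¹) * (Lf * γ) * (1 + 4 * γ)) * (1 + 4 * v) * (1 + τ)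
    ∧ 0 ≤ (1 + τ + (1 + τ⁻¹) * (Lf * γ) * (1 + 4 * γ)) * (1 + 4 * v) * (4 * v) + 4 * ((1 + τ⁻¹) * (Lf * γ)) := by
  obtain ⟨h42, h3, h2, h4⟩ := pow_facts hτ0.le hτ1
  have hτ41 : τ ^ 4 ≤ 1 := h4.trans hτ1
  have hi0 : 0 ≤ 1 + τ⁻¹ := add_nonneg zero_le_one (inv_nonneg.mpr hτ0.le)
  have hLfs0 : 0 ≤ Lfs := hLf0.trans hLf
  have hv1 : v ≤ Vs := hvle.trans (mul_le_of_le_one_right hVs0 hτ1)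
  have hγ1 : γ ≤ Gs := hγle.trans (mul_le_of_le_one_right hGs0 hτ41)
  have hLG : (1 + τ⁻¹) * (Lf * γ) ≤ 2 * (Lfs * Gs) * τ := by
    have h1 : Lf * γ ≤ (Lfs * Gs) * τ ^ 4 := by
      calc Lf * γ ≤ Lfs * (Gs * τ ^ 4) := mul_le_mul hLf hγle hγ0 hLfs0
        _ = _ := by ring
    exact (mul_le_mul_of_nonneg_left h1 hi0).trans (one_add_inv_mul_pow4_le hτ0 hτ1 (by positivity))
  have hLG0 : 0 ≤ (1 + τ⁻¹) * (Lf * γ) := by positivity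
  have hP : 1 + τ + (1 + τ⁻¹) * (Lf * γ) * (1 + 4 * γ) ≤ 1 + (1 + 2 * (Lfs * Gs) * (1 + 4 * Gs)) * τ := by
    have h1 : (1 + τ⁻¹) * (Lf * γ) * (1 + 4 * γ) ≤ (2 * (Lfs * Gs) * τ) * (1 + 4 * Gs) := mul_le_mul hLG (by linarith) (by positivity) (by positivity)
    have e : 1 + (1 + 2 * (Lfs * Gs) * (1 + 4 * Gs)) * τ = 1 + τ + (2 * (Lfs * Gs) * τ) * (1 + 4 * Gs) := by ring
    rw [e]; linarith
  have hP0 : 0 ≤ 1 + τ + (1 + τ⁻¹) * (Lf * γ) * (1 + 4 * γ) := by positivity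
  have hp0 : 0 ≤ (1 + 2 * (Lfs * Gs) * (1 + 4 * Gs)) := by positivity
  have hP1 : 1 + τ + (1 + τ⁻¹) * (Lf * γ) * (1 + 4 * γ) ≤ 1 + (1 + 2 * (Lfs * Gs) * (1 + 4 * Gs)) := hP.trans (by nlinarith)
  have hAle : (1 + τ + (1 + τ⁻¹) * (Lf * γ) * (1 + 4 * γ)) * (1 + 4 * v) * (1 + τ) ≤ ((1 + (1 + 2 * (Lfs * Gs) * (1 + 4 * Gs))) * (1 + 4 * Vs) * 2) :=
    mul_le_mul (mul_le_mul hP1 (by linarith) (by positivity) (by positivity)) (by linarith) (by positivity) (by positivity)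
  have hA1 : (1 + τ + (1 + τ⁻¹) * (Lf * γ) * (1 + 4 * γ)) * (1 + 4 * v) * (1 + τ) - 1 ≤ (1 + 2 * (1 + 2 * (Lfs * Gs) * (1 + 4 * Gs)) + 8 * Vs + 8 * (1 + 2 * (Lfs * Gs) * (1 + 4 * Gs)) * Vs) * τ := by
    have h1 : (1 + τ + (1 + τ⁻¹) * (Lf * γ) * (1 + 4 * γ)) * (1 + 4 * v) * (1 + τ) ≤ (1 + (1 + 2 * (Lfs * Gs) * (1 + 4 * Gs)) * τ) * (1 + 4 * (Vs * τ)) * (1 + τ) :=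
      mul_le_mul (mul_le_mul hP (by linarith) (by positivity) (by positivity)) le_rfl (by positivity) (by positivity)
    have h2' : (1 + (1 + 2 * (Lfs * Gs) * (1 + 4 * Gs)) * τ) * (1 + 4 * (Vs * τ)) * (1 + τ) - 1 ≤ (1 + 2 * (1 + 2 * (Lfs * Gs) * (1 + 4 * Gs)) + 8 * Vs + 8 * (1 + 2 * (Lfs * Gs) * (1 + 4 * Gs)) * Vs) * τ := by
      have q1 : (1 + 2 * (Lfs * Gs) * (1 + 4 * Gs)) * τ ^ 2 ≤ (1 + 2 * (Lfs * Gs) * (1 + 4 * Gs)) * τ := mul_le_mul_of_nonneg_left h2 hp0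
      have q2 : Vs * τ ^ 2 ≤ Vs * τ := mul_le_mul_of_nonneg_left h2 hVs0
      have q3 : (1 + 2 * (Lfs * Gs) * (1 + 4 * Gs)) * Vs * τ ^ 2 ≤ (1 + 2 * (Lfs * Gs) * (1 + 4 * Gs)) * Vs * τ := mul_le_mul_of_nonneg_left h2 (mul_nonneg hp0 hVs0)
      have q4 : (1 + 2 * (Lfs * Gs) * (1 + 4 * Gs)) * Vs * τ ^ 3 ≤ (1 + 2 * (Lfs * Gs) * (1 + 4 * Gs)) * Vs * τ := mul_le_mul_of_nonneg_left h3 (mul_nonneg hp0 hVs0)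
      have e : (1 + (1 + 2 * (Lfs * Gs) * (1 + 4 * Gs)) * τ) * (1 + 4 * (Vs * τ)) * (1 + τ) - 1
          = (1 + 4 * Vs + (1 + 2 * (Lfs * Gs) * (1 + 4 * Gs))) * τ + (4 * (Vs * τ ^ 2) + (1 + 2 * (Lfs * Gs) * (1 + 4 * Gs)) * τ ^ 2 + 4 * ((1 + 2 * (Lfs * Gs) * (1 + 4 * Gs)) * Vs * τ ^ 2)) + 4 * ((1 + 2 * (Lfs * Gs) * (1 + 4 * Gs)) * Vs * τ ^ 3) := by ring
      rw [e]
      linarith only [q1, q2, q3, q4]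
    linarith
  have hBle : (1 + τ + (1 + τ⁻¹) * (Lf * γ) * (1 + 4 * γ)) * (1 + 4 * v) * (4 * v) + 4 * ((1 + τ⁻¹) * (Lf * γ)) ≤ (4 * Vs * ((1 + (1 + 2 * (Lfs * Gs) * (1 + 4 * Gs))) * (1 + 4 * Vs)) + 8 * (Lfs * Gs)) * τ := by
    have h1 : (1 + τ + (1 + τ⁻¹) * (Lf * γ) * (1 + 4 * γ)) * (1 + 4 * v) * (4 * v) ≤ ((1 + (1 + 2 * (Lfs * Gs) * (1 + 4 * Gs))) * (1 + 4 * Vs)) * (4 * (Vs * τ)) :=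
      mul_le_mul (mul_le_mul hP1 (by linarith) (by positivity) (by positivity)) (by linarith) (by positivity) (by positivity)
    have h2' : 4 * ((1 + τ⁻¹) * (Lf * γ)) ≤ 4 * (2 * (Lfs * Gs) * τ) := mul_le_mul_of_nonneg_left hLG (by norm_num)
    calc _ ≤ ((1 + (1 + 2 * (Lfs * Gs) * (1 + 4 * Gs))) * (1 + 4 * Vs)) * (4 * (Vs * τ)) + 4 * (2 * (Lfs * Gs) * τ) := add_le_add h1 h2'
      _ = _ := by ring
  have h1A : 1 ≤ (1 + τ + (1 + τ⁻¹) * (Lf * γ) * (1 + 4 * γ)) * (1 + 4 * v) * (1 + τ) := by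
    have hP1' : 1 ≤ 1 + τ + (1 + τ⁻¹) * (Lf * γ) * (1 + 4 * γ) := by
      have : 0 ≤ (1 + τ⁻¹) * (Lf * γ) * (1 + 4 * γ) := by positivity
      linarith
    have h14v : (1 : ℝ) ≤ 1 + 4 * v := by linarith
    have h1τ : (1 : ℝ) ≤ 1 + τ := by linarith
    calc (1 : ℝ) = 1 * 1 * 1 := by norm_num
      _ ≤ (1 + τ + (1 + τ⁻¹) * (Lf * γ) * (1 + 4 * γ)) * (1 + 4 * v) * (1 + τ) :=
          mul_le_mul (mul_le_mul hP1' h14v zero_le_one hP0) h1τ zero_le_one (mul_nonneg hP0 (by positivity))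
  exact ⟨by positivity, hAle, hA1, hBle, by positivity, h1A, by positivity⟩

/-! ## §6 The outputs `ε₁ = (A−1) + A·ε + B`, `δ′₁ = √A·δ′` -/

/-- **THE (ONE-min) TRANSFER OUTPUTS DECAY LIKE `τ = θ^k`** — `hONEm_taxi`'s `let` telescope over abstract atoms with `s = t = u = u₂ = w := τ`: from the atom bounds
of the taxi class, `0 ≤ ε`, `0 ≤ δ′`, `v ≤ V⋆`, `γ ≤ Γ⋆`, `0 ≤ (A−1) + A·ε + B ≤ (A₁⋆ + A⋆E⋆ + B⋆)·τ`, `0 ≤ √A·δ′ ≤ √A⋆·D⋆·τ` (starred constants = the `let`s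
`EHs … As` of the statement, k-free polynomials ∕ roots in the class constants). [folklore] -/
theorem oneMin_outputs_le {d L : ℕ} {N a X Y F R NB Lv Lf Λ CP CR CRv CD CD' CD₁ CD₁' c CX CY RPc Lvs Lfs τ : ℝ}
    (hτ0 : 0 < τ) (hτ1 : τ ≤ 1) (hN0 : 0 < N) (hNi : (N ^ 2)⁻¹ ≤ τ ^ 4)
    (ha0 : 0 ≤ a) (hna : N ^ 2 * a ≤ c) (haN : a ^ 2 * N ^ 2 ≤ c ^ 2 * τ ^ 4)
    (hX0 : 0 ≤ X) (hCX0 : 0 ≤ CX) (hXN : N * X ≤ CX * τ ^ 2) (hX : X ≤ CX * τ ^ 4)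
    (hY0 : 0 ≤ Y) (hCY0 : 0 ≤ CY) (hYN : N * Y ≤ CY * τ ^ 2) (hY : Y ≤ CY * τ ^ 4)
    (hF0 : 0 ≤ F) (hF : F ≤ c * τ ^ 2) (hR0 : 0 ≤ R) (hR : R ≤ RPc) (hNB0 : 0 ≤ NB) (hNB : NB ≤ c)
    (hLv0 : 0 ≤ Lv) (hLv : Lv ≤ Lvs) (hLf0 : 0 ≤ Lf) (hLf : Lf ≤ Lfs)
    (hΛ : 0 ≤ Λ) (hCP : 0 ≤ CP) (hCR : 0 ≤ CR) (hCRv : 0 ≤ CRv) (hCD : 0 ≤ CD) (hCD' : 0 ≤ CD') (hCD₁ : 0 ≤ CD₁) (hCD₁' : 0 ≤ CD₁') (hc0 : 0 ≤ c) :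
    let eH : ℝ := (((d : ℝ) / 4 + 1 / 2) * ((L : ℝ) / N ^ 2)) * CR * (Λ + 1)
        + 2 * (Real.sqrt (2 * d * (1 + (d : ℝ) ^ 2)) * (N * L * X))
          * Real.sqrt ((Λ + (((d : ℝ) / 4 + 1 / 2) * ((L : ℝ) / N ^ 2)) * CR * (Λ + 1)) * (CP * (Λ + 1)))
        + (Real.sqrt (2 * d * (1 + (d : ℝ) ^ 2)) * (N * L * X)) ^ 2 * (CP * (Λ + 1))
        + 2 * (Real.sqrt d * (N * Y)) * Real.sqrt (Λ * (CP * (Λ + 1)))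
    let e₂ : ℝ := τ + 3 * (1 + τ⁻¹) * (8 * d * ((N ^ 2)⁻¹ * CRv
          + (1 + X) ^ 2 * ((d : ℝ) / 4 * L * ((N ^ 2)⁻¹ * CRv)) + X ^ 2 * ((2 * (1 + CD)) + (2 * (CD' + d * (N ^ 2 * a) * 64)))
          + X ^ 2 * (2 * (1 + (d : ℝ) ^ 2) * (L : ℝ) ^ 2 * (N ^ 2 * (max (40 * (2 * (1 + CD))) (64 + 40 * (2 * (CD' + d * (N ^ 2 * a) * 64)))))))
        + (d : ℝ) / 2 * (2 * d * ((N ^ 2)⁻¹ * CRv) + 2 * (d : ℝ) ^ 2 * a ^ 2 * (N ^ 2 * (max (40 * (2 * (1 + CD))) (64 + 40 * (2 * (CD' + d * (N ^ 2 * a) * 64))))))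
        + (d : ℝ) / 4 * (2 * (2 * d * ((N ^ 2)⁻¹ * CRv) + 2 * (d : ℝ) ^ 2 * a ^ 2 * (N ^ 2 * (max (40 * (2 * (1 + CD))) (64 + 40 * (2 * (CD' + d * (N ^ 2 * a) * 64)))))) + 2 * (Λ * (N ^ 2)⁻¹ * (CD + CD')))
        + CP * eH * (CD + CD'))
    let ε : ℝ := τ + (1 + τ) * ((τ + (1 + τ⁻¹) * (d * (L : ℝ) / N ^ 2)) * (1 + CRv) + e₂)
      + (1 + τ⁻¹) * (Lv * (25 / 4 * ((N ^ 2)⁻¹ * ((2 * (1 + CD)) + (2 * (CD' + d * (N ^ 2 * a) * 64))))))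
    let δ' : ℝ := Real.sqrt (8 * d * (1 + (d : ℝ) ^ 2)) * (N * L * X)
    let v : ℝ := (1 + τ⁻¹) * (4 * ((d : ℝ) * ((d : ℝ) * F))
          * R) ^ 2
        * ((d : ℝ) * ((2 * (1 + CD₁)) + (2 * (CD₁' + d * NB * 64))))
    let γ : ℝ := (3 * Y) ^ 2 * max (40 * (2 * (1 + CD₁))) (64 + 40 * (2 * (CD₁' + d * NB * 64)))
    let A : ℝ := (1 + τ + (1 + τ⁻¹) * (Lf * γ) * (1 + 4 * γ)) * (1 + 4 * v) * (1 + τ)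
    let B : ℝ := (1 + τ + (1 + τ⁻¹) * (Lf * γ) * (1 + 4 * γ)) * (1 + 4 * v) * (4 * v) + 4 * ((1 + τ⁻¹) * (Lf * γ))
    -- the starred constants
    let EHs : ℝ := ((((d : ℝ) / 4 + 1 / 2) * L) * CR * (Λ + 1)
          + 2 * (Real.sqrt (2 * d * (1 + (d : ℝ) ^ 2)) * (L * CX)) * Real.sqrt ((Λ + (((d : ℝ) / 4 + 1 / 2) * L) * CR * (Λ + 1)) * (CP * (Λ + 1)))
          + (Real.sqrt (2 * d * (1 + (d : ℝ) ^ 2)) * (L * CX)) ^ 2 * (CP * (Λ + 1))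
          + 2 * (Real.sqrt d * CY) * Real.sqrt (Λ * (CP * (Λ + 1))))
    let E2s : ℝ := (1 + 6 * ((8 * d * (CRv + (1 + CX) ^ 2 * ((d : ℝ) / 4 * L * CRv) + CX ^ 2 * ((2 * (1 + CD)) + (2 * (CD' + d * c * 64))) + 2 * (1 + (d : ℝ) ^ 2) * (L : ℝ) ^ 2 * (CX ^ 2 * (max (40 * (2 * (1 + CD))) (64 + 40 * (2 * (CD' + d * c * 64))))))) + ((d : ℝ) / 2 * (2 * d * CRv + 2 * (d : ℝ) ^ 2 * (c ^ 2 * (max (40 * (2 * (1 + CD))) (64 + 40 * (2 * (CD' + d * c * 64))))))) + ((d : ℝ) / 4 * (2 * (2 * d * CRv + 2 * (d : ℝ) ^ 2 * (c ^ 2 * (max (40 * (2 * (1 + CD))) (64 + 40 * (2 * (CD' + d * c * 64)))))) + 2 * (Λ * (CD + CD')))) + (CP * EHs * (CD + CD'))))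
    let EPSs : ℝ := (1 + 2 * ((1 + 2 * (d * (L : ℝ))) * (1 + CRv) + E2s) + 2 * (Lvs * (25 / 4 * ((2 * (1 + CD)) + (2 * (CD' + d * c * 64))))))
    let Vs : ℝ := (2 * ((4 * ((d : ℝ) * ((d : ℝ) * c)) * RPc) ^ 2 * ((d : ℝ) * ((2 * (1 + CD₁)) + (2 * (CD₁' + d * c * 64))))))
    let Gs : ℝ := ((3 * CY) ^ 2 * (max (40 * (2 * (1 + CD₁))) (64 + 40 * (2 * (CD₁' + d * c * 64)))))
    let DPRs : ℝ := (Real.sqrt (8 * d * (1 + (d : ℝ) ^ 2)) * (L * CX))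
    let p : ℝ := (1 + 2 * (Lfs * Gs) * (1 + 4 * Gs))
    let As : ℝ := (1 + p) * (1 + 4 * Vs) * 2
    0 ≤ ε ∧ 0 ≤ δ' ∧ v ≤ Vs ∧ γ ≤ Gs ∧
      0 ≤ (A - 1) + A * ε + B ∧ (A - 1) + A * ε + B ≤ ((1 + 2 * p + 8 * Vs + 8 * p * Vs) + As * EPSs + (4 * Vs * ((1 + p) * (1 + 4 * Vs)) + 8 * (Lfs * Gs))) * τ ∧
      0 ≤ Real.sqrt A * δ' ∧ Real.sqrt A * δ' ≤ (Real.sqrt As * DPRs) * τ := by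
  intro eH e₂ ε δ' v γ A B EHs E2s EPSs Vs Gs DPRs p As
  obtain ⟨h42, h3, h2, h4⟩ := pow_facts hτ0.le hτ1
  have hτ41 : τ ^ 4 ≤ 1 := h4.trans hτ1
  have heH0 : 0 ≤ eH := eH_nonneg (d := d) (L := L) hN0 hX0 hY0 hΛ hCP hCR
  have hEHs0 : 0 ≤ EHs := EHs_nonneg (d := d) (L := L) hCX0 hCY0 hΛ hCP hCR
  have heH : eH ≤ EHs * τ ^ 2 := eH_le (d := d) (L := L) hτ0 hτ1 hN0 hNi hX0 hCX0 hXN hY0 hYN hΛ hCP hCR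
  have he2 : 0 ≤ e₂ ∧ e₂ ≤ E2s * τ :=
    e2_le (d := d) (L := L) hτ0 hτ1 hN0 hNi ha0 hna haN hX0 hCX0 hXN hX hCRv hCD hCD' hΛ hCP hc0 heH0 heH hEHs0
  have hε : 0 ≤ ε ∧ ε ≤ EPSs * τ := eps_le (d := d) (L := L) hτ0 hτ1 hNi ha0 hna hCRv hCD hCD' hc0 he2.1 he2.2 hLv0 hLv
  have hv : 0 ≤ v ∧ v ≤ Vs * τ ∧ 0 ≤ Vs := v_le (d := d) hτ0 hτ1 hF0 hF hR0 hR hNB0 hNB hCD₁ hCD₁' hc0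
  have hγ : 0 ≤ γ ∧ γ ≤ Gs * τ ^ 4 ∧ 0 ≤ Gs := gamma_le (d := d) hτ0 hτ1 hY0 hY hNB hCD₁
  have hδ : 0 ≤ δ' ∧ δ' ≤ DPRs * τ ^ 2 ∧ 0 ≤ DPRs := deltaP_le (d := d) (L := L) hN0 hX0 hCX0 hXN
  have hAB : 0 ≤ A ∧ A ≤ As ∧ A - 1 ≤ (1 + 2 * p + 8 * Vs + 8 * p * Vs) * τ ∧ B ≤ (4 * Vs * ((1 + p) * (1 + 4 * Vs)) + 8 * (Lfs * Gs)) * τ ∧ 0 ≤ As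
      ∧ 1 ≤ A ∧ 0 ≤ B :=
    AB_le hτ0 hτ1 hv.1 hv.2.1 hγ.1 hγ.2.1 hLf0 hLf hv.2.2 hγ.2.2
  have hout0 : 0 ≤ (A - 1) + A * ε + B := add_nonneg (add_nonneg (sub_nonneg.mpr hAB.2.2.2.2.2.1) (mul_nonneg hAB.1 hε.1)) hAB.2.2.2.2.2.2
  refine ⟨hε.1, hδ.1, hv.2.1.trans (mul_le_of_le_one_right hv.2.2 hτ1), hγ.2.1.trans (mul_le_of_le_one_right hγ.2.2 hτ41), hout0, ?_,
    mul_nonneg (Real.sqrt_nonneg _) hδ.1, ?_⟩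
  · have h1 : A * ε ≤ As * (EPSs * τ) := mul_le_mul hAB.2.1 hε.2 hε.1 hAB.2.2.2.2.1
    calc (A - 1) + A * ε + B ≤ (1 + 2 * p + 8 * Vs + 8 * p * Vs) * τ + As * (EPSs * τ) + (4 * Vs * ((1 + p) * (1 + 4 * Vs)) + 8 * (Lfs * Gs)) * τ :=
          add_le_add (add_le_add hAB.2.2.1 h1) hAB.2.2.2.1
      _ = _ := by ring
  · calc Real.sqrt A * δ' ≤ Real.sqrt As * (DPRs * τ ^ 2) := mul_le_mul (Real.sqrt_le_sqrt hAB.2.1) hδ.2.1 hδ.1 (Real.sqrt_nonneg _)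
      _ = (Real.sqrt As * DPRs) * τ ^ 2 := by ring
      _ ≤ (Real.sqrt As * DPRs) * τ := mul_le_mul_of_nonneg_left h2 (mul_nonneg (Real.sqrt_nonneg _) hδ.2.2)

end Summit.QuantumFields.BalabanUV.T4Continuum.VariationalColourTaxiOneMinDecay

end
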